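import Literature.Probability.LatticeModels.AxisSpectralRepresentation
import Literature.Probability.LatticeModels.TwoPointLogConvex
import Literature.LinearAlgebra.Matrix.PerronSymmetric
import HarnessLib

/-!
# Proof of the axis spectral representation (Aizenman–Duminil-Copin 2021, Prop. 8.6 = Prop. 5.3)

Topic `Literature/Probability/LatticeModels`; family `crit-ising`. This file DISCHARGES the named
fact `AizenmanDuminilCopin2021_prop_8_6` of `AxisSpectralRepresentation.lean`:

* `AizenmanDuminilCopin2021_prop_8_6_holds` — for the nearest-neighbour Ising model on `ℤ^{d'+1}`,
  every `β > 0` with `m*(β) = 0` and every axis `i`, there is a finite positive measure `μ` on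
  `[0, ∞)` with `⟨σ₀ σ_{n eᵢ}⟩⁺_β = ∫ e^{-a|n|} dμ(a)` for all `n ∈ ℤ`.

No definition, no named fact, no sorry: theorem-only file (helpers in the sub-namespace
`AxisSpectral`, which names the object constructed here, the axis spectral measure).

## The printed proof and how it is followed

Source (held, read at the page: arXiv:1912.07973 = Ann. of Math. 194 (2021), Appendix §8.3,
text chunks p0032 L45 – p0033 L75). ADC prove Prop. 8.6 in three steps: (1) on periodic tubes the
transfer matrix `T` is self-adjoint and **positive** ("by the criteria of [FroSimSpe76] applied to
the reflection symmetry with respect to the hyperplanes passing through mid-edges"), so by its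
spectral decomposition the axis two-point function is a combination of `λ₁^{m-n} λ₂ⁿ` with
nonnegative weights, eq. (212); (2) letting the length of the tube tend to infinity only the top
eigenvalue survives and one gets `∫ e^{-an} dμ_ℓ(a)`, `e^{-a} = λ/λ_max`; (3) `ℓ → ∞` by the pointwise
convergence of the finite-volume correlations and "the moment criterion for the convergence of
positive measures over bounded intervals (here `[0,1]`)".

We follow this with two deviations dictated by the tree and by rigour.

* **Finite volume = the cubic torus `(ℤ/Nℤ)^{d'+1}`, joint limit `N → ∞`** (Parts A, C): the tree
  already has the transfer-matrix representation of the torus two-point function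
  (`TorusTransferSpectral`: `transferMatrix`, `transferMatrix_posSemidef`,
  `sum_exp_mul_layerObs_eq_trace`; `TwoPointLogConvex`: `Z_mul_torusAxisForm_eq_trace`) and the
  convergence `⟨σ₀σ_x⟩_{𝕋_N;β} → ⟨σ₀σ_x⟩⁺_β` when `m*(β) = 0` (`TorusTwoPointLimit`, ADC Prop. 5.2,
  in the form `tendsto_isingTorusTwoPoint_proj_of_magnetization_eq_zero`), but no tube states. On
  the torus of length `N` the thermal trace gives the EXACT representation
  `⟨σ₀σ_{neᵢ}⟩_{𝕋_N} = ∫ λⁿ dν_N(λ)`, `0 ≤ n < N`, with the finitely supported positive measure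
  `ν_N = ∑_{k,l} (c_{kl} λ_k^N/Z) δ_{λ_l/λ_k}` on `[0, ∞)` (ratios `> 1` occur, with tiny weights:
  the moment of order `N - 1` is a two-point function, `≤ 1`, which controls the tails). Step (2)
  of the printed proof is thereby absorbed into step (3).
* **No atom at `λ = 0`** (Part B). The weak limit on `[0,1]` of the printed proof may charge the
  point `λ = e^{-a} = 0` (`a = +∞`), which is invisible in all moments `n ≥ 1` but would break the
  identity at `n = 0` (total mass `⟨σ₀²⟩ = 1`) claimed in Prop. 8.6; the printed proof does not
  address this. We supply the missing estimate: at `β > 0` the one-site transfer matrix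
  `k = e^{β}(1 + tX)`, `t = e^{-2β} < 1`, is invertible and `k⁻¹ Z k = [(1+t²)Z + 2t ZX]/(1-t²)`, whence
  an intertwiner `σ_{y₀} A = A S'` for the symmetrised transfer matrix `A = DKD` with
  `‖S'‖ ≤ C(β, d')` UNIFORMLY in `N` (a single flip changes the intra-layer energy by `≤ 4d'`).
  In the eigenbasis this reads `(UᵀσU)_{kl} λ_l = λ_k (UᵀS'U)_{kl}`, so the weight of the atom at
  `λ_l/λ_k` carries a factor `(λ_l/λ_k)²`: `ν_N([0,δ]) ≤ C² δ²` uniformly in `N`, and the limit has no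
  atom at `0`. (At `β = 0` the atom is really there: `⟨σ₀σ_{neᵢ}⟩ = 𝟙[n = 0]`; Prop. 8.6 assumes
  `β > 0`.)
* **The limit** (Part D) is the printed step (3), done with Mathlib's weak compactness of finite
  measures of bounded mass on a compact set (`isCompact_setOf_finiteMeasure_le_of_isCompact`, the
  Riesz–Markov–Kakutani / Prokhorov file): restrict `ν_N` to `[0,2]`, take a weak cluster point `ν̄`,
  read off `∫ λⁿ dν̄ = ⟨σ₀σ_{neᵢ}⟩⁺_β` (all `n ≥ 0`), kill `(1,2]` with `⟨σ₀σ_{neᵢ}⟩⁺ ≤ 1`, kill `{0}` with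
  the uniform bound, and change variables `a = -log λ`.

## References

* M. Aizenman, H. Duminil-Copin, *Marginal triviality of the scaling limits of critical 4D Ising and
  `λφ⁴₄` models*, Ann. of Math. 194 (2021) 163–235 = arXiv:1912.07973: Prop. 5.3 (§5.3), Prop. 5.2,
  and Appendix §8.3, Prop. 8.6 with its proof (eqs. (212), (101)). [AizenmanDuminilCopinAnnals2021]
* T. D. Schultz, D. C. Mattis, E. H. Lieb, Rev. Mod. Phys. 36 (1964) 856, §II (the symmetrised
  transfer matrix `V = V₂^{1/2} V₁ V₂^{1/2}`) — through `TorusTransferSpectral`. [SchultzMattisLieb1964]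
* J. Glimm, A. Jaffe, *Quantum Physics* (1987), §6.1 (transfer matrix and spectral representation),
  cited by the source as [GliJaf73].

## Mathlib

`Matrix.IsHermitian.spectral_theorem` (through `Literature.LinearAlgebra.Matrix.PerronSymmetric`:
`eigU`, `spectral_real`, `pow_eq_eigU_mul`, `trace_pow_eq_sum`, `dotProduct_self_eq_sum`),
`MeasureTheory.FiniteMeasure` with its weak topology and
`FiniteMeasure.continuous_integral_boundedContinuousFunction`,
`isCompact_setOf_finiteMeasure_le_of_isCompact` (`Mathlib/MeasureTheory/Measure/Prokhorov.lean`),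
`IsCompact.exists_clusterPt`, `MapClusterPt.tendsto_comp`, `IsClosed.mem_of_mapClusterPt`,
`BoundedContinuousFunction.ofNormedAddCommGroup`, `integral_finsetSum_measure`, `integral_dirac`,
`integral_map`, `Real.exp_log`.
-/

noncomputable section

namespace Literature.Probability.LatticeModels

namespace AxisSpectral

open Literature.LinearAlgebra.Matrix

/-! ### Part A. Spectral weights of a two-insertion trace with an intertwiner -/

section LinAlg

open Matrix Finset

variable {ι : Type*} [Fintype ι] [DecidableEq ι]

/-- **Spectral weights with an intertwiner.** Let `A` be a positive semidefinite real symmetric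
matrix, `S = diag f` a diagonal observable and `S'` ANY matrix intertwining `S` through `A`,
`S A = A S'`, with `‖S' v‖² ≤ B ‖v‖²`. Then, with `λ_k ≥ 0` the eigenvalues and
`c_{kl} = (UᵀSU)_{kl}² ≥ 0`, `c'_{kl} = (UᵀS'U)_{lk}² ≥ 0`:
`Tr(S Aⁿ S Aᵐ) = ∑_{k,l} c_{kl} λ_lⁿ λ_kᵐ`, `Tr(Aᵐ) = ∑_k λ_kᵐ`, `λ_k² c_{kl} = λ_l² c'_{kl}` (from
`(UᵀSU) Λ = Λ (UᵀS'U)`) and `∑_l c'_{kl} ≤ B` (orthogonality of `U`). The relation says that the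
spectral measure `∑ c_{kl} δ_{λ_l/λ_k}` carries a factor `(λ_l/λ_k)²`: no mass accumulates at `0`.
[folklore] -/
theorem exists_spectralWeights_of_intertwiner {A : Matrix ι ι ℝ} (hA : A.PosSemidef) (f : ι → ℝ)
    (S' : Matrix ι ι ℝ) (hS : diagonal f * A = A * S') (B : ℝ)
    (hB : ∀ v : ι → ℝ, ∑ a, (S' *ᵥ v) a ^ 2 ≤ B * ∑ a, v a ^ 2) :
    ∃ (ev : ι → ℝ) (c c' : ι → ι → ℝ), (∀ k, 0 ≤ ev k) ∧ (∀ k l, 0 ≤ c k l) ∧ (∀ k l, 0 ≤ c' k l) ∧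
      (∀ n m : ℕ, (diagonal f * A ^ n * diagonal f * A ^ m).trace =
        ∑ k, ∑ l, c k l * (ev l ^ n * ev k ^ m)) ∧
      (∀ m : ℕ, (A ^ m).trace = ∑ k, ev k ^ m) ∧
      (∀ k l, ev k ^ 2 * c k l = ev l ^ 2 * c' k l) ∧
      (∀ k, ∑ l, c' k l ≤ B) := by
  classical
  have hH : A.IsHermitian := hA.1
  set U : Matrix ι ι ℝ := eigU hH with hU
  set ev : ι → ℝ := hH.eigenvalues with hev
  have hUU : star U * U = 1 := star_eigU_mul hH
  have hUU' : U * star U = 1 := eigU_mul_star hH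
  have hspec : ∀ M : ℕ, A ^ M = U * diagonal (fun i => ev i ^ M) * star U := pow_eq_eigU_mul hH
  have hspec1 : A = U * diagonal ev * star U := spectral_real hH
  -- the observables in the eigenbasis
  set M : Matrix ι ι ℝ := star U * diagonal f * U with hM
  set M' : Matrix ι ι ℝ := star U * S' * U with hM'
  have hMapply : ∀ k l, M k l = ∑ a, U a k * f a * U a l := by
    intro k l
    simp only [hM, Matrix.mul_apply, Matrix.star_apply, star_trivial, Matrix.diagonal_apply, mul_ite,
      mul_zero, Finset.sum_ite_eq', Finset.mem_univ, if_true]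
  have hMsym : ∀ k l, M k l = M l k := by
    intro k l
    simp only [hMapply]
    exact Finset.sum_congr rfl fun a _ => by ring
  -- `Uᵀ A U = Λ`
  have hUAU : star U * A * U = diagonal ev := by
    rw [hspec1]
    calc star U * (U * diagonal ev * star U) * U
        = (star U * U) * diagonal ev * (star U * U) := by simp only [Matrix.mul_assoc]
      _ = diagonal ev := by rw [hUU, Matrix.one_mul, Matrix.mul_one]
  -- the intertwining relation in the eigenbasis: `M Λ = Λ M'`
  have hMΛ : M * diagonal ev = diagonal ev * M' := by
    have h1 : star U * (diagonal f * A) * U = M * diagonal ev := by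
      calc star U * (diagonal f * A) * U
          = star U * diagonal f * (U * star U) * A * U := by
            rw [hUU', Matrix.mul_one]; simp only [Matrix.mul_assoc]
        _ = (star U * diagonal f * U) * (star U * A * U) := by simp only [Matrix.mul_assoc]
        _ = M * diagonal ev := by rw [hUAU]
    have h2 : star U * (A * S') * U = diagonal ev * M' := by
      calc star U * (A * S') * U
          = star U * A * (U * star U) * S' * U := by
            rw [hUU', Matrix.mul_one]; simp only [Matrix.mul_assoc]
        _ = (star U * A * U) * (star U * S' * U) := by simp only [Matrix.mul_assoc]
        _ = diagonal ev * M' := by rw [hUAU]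
    rw [← h1, ← h2, hS]
  have hrel : ∀ k l, M k l * ev l = ev k * M' k l := by
    intro k l
    have h := congrFun (congrFun hMΛ k) l
    rwa [Matrix.mul_diagonal, Matrix.diagonal_mul] at h
  refine ⟨ev, fun k l => M k l ^ 2, fun k l => M' l k ^ 2, fun k => hA.eigenvalues_nonneg k,
    fun k l => sq_nonneg _, fun k l => sq_nonneg _, fun n m => ?_, fun m => trace_pow_eq_sum hH m,
    fun k l => ?_, fun k => ?_⟩
  · -- the two-insertion trace
    set Dn : Matrix ι ι ℝ := diagonal fun i => ev i ^ n with hDn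
    set Dm : Matrix ι ι ℝ := diagonal fun i => ev i ^ m with hDm
    calc (diagonal f * A ^ n * diagonal f * A ^ m).trace
        = (diagonal f * (U * Dn * star U) * diagonal f * (U * Dm * star U)).trace := by
          rw [hspec n, hspec m]
      _ = ((diagonal f * U * Dn * (star U * diagonal f * U) * Dm) * star U).trace := by
          simp only [Matrix.mul_assoc]
      _ = (star U * (diagonal f * U * Dn * (star U * diagonal f * U) * Dm)).trace :=
          Matrix.trace_mul_comm _ _
      _ = (M * Dn * M * Dm).trace := by
          simp only [hM, Matrix.mul_assoc]
      _ = ∑ k, ∑ l, M k l * M l k * (ev l ^ n * ev k ^ m) := by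
          simp only [Matrix.trace, Matrix.diag_apply, hDm, hDn, Matrix.mul_apply, Matrix.diagonal_apply,
            mul_ite, mul_zero, Finset.sum_ite_eq', Finset.mem_univ, if_true, Finset.sum_mul]
          refine Finset.sum_congr rfl fun k _ => Finset.sum_congr rfl fun l _ => ?_
          ring
      _ = ∑ k, ∑ l, M k l ^ 2 * (ev l ^ n * ev k ^ m) := by
          refine Finset.sum_congr rfl fun k _ => Finset.sum_congr rfl fun l _ => ?_
          rw [hMsym l k, sq]
  · -- `λ_k² c_{kl} = λ_l² c'_{kl}`
    show ev k ^ 2 * M k l ^ 2 = ev l ^ 2 * M' l k ^ 2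
    have h := hrel l k
    rw [hMsym k l]
    calc ev k ^ 2 * M l k ^ 2 = (M l k * ev k) ^ 2 := by ring
      _ = (ev l * M' l k) ^ 2 := by rw [h]
      _ = ev l ^ 2 * M' l k ^ 2 := by ring
  · -- `∑_l c'_{kl} = ‖Uᵀ (S' u_k)‖² = ‖S' u_k‖² ≤ B ‖u_k‖² = B`
    show ∑ l, M' l k ^ 2 ≤ B
    set u : ι → ℝ := fun a => U a k with hu
    have hcol : ∀ l, M' l k = (star U *ᵥ (S' *ᵥ u)) l := by
      intro l
      simp only [hM', hu, Matrix.mul_apply, Matrix.mulVec, dotProduct, Matrix.star_apply, star_trivial,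
        Finset.sum_mul]
      rw [Finset.sum_comm]
      refine Finset.sum_congr rfl fun a _ => ?_
      rw [Finset.mul_sum]
      refine Finset.sum_congr rfl fun b _ => ?_
      ring
    have hnorm : ∑ l, (star U *ᵥ (S' *ᵥ u)) l ^ 2 = ∑ a, (S' *ᵥ u) a ^ 2 := by
      rw [← dotProduct_self_eq_sum hH (S' *ᵥ u)]
      simp only [dotProduct]
      exact Finset.sum_congr rfl fun a _ => by ring
    have hunit : ∑ a, u a ^ 2 = 1 := by
      have h := congrFun (congrFun hUU k) k
      simp only [Matrix.mul_apply, Matrix.star_apply, star_trivial, Matrix.one_apply_eq] at h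
      rw [← h]
      exact Finset.sum_congr rfl fun a _ => by rw [hu, sq]
    calc ∑ l, M' l k ^ 2 = ∑ l, (star U *ᵥ (S' *ᵥ u)) l ^ 2 := Finset.sum_congr rfl fun l _ => by rw [hcol l]
      _ = ∑ a, (S' *ᵥ u) a ^ 2 := hnorm
      _ ≤ B * ∑ a, u a ^ 2 := hB u
      _ = B := by rw [hunit, mul_one]

end LinAlg

/-! ### Part B. The Ising intertwiner `σ_{y₀} A = A S'` -/

section Intertwiner

open Matrix Finset

variable {d' N : ℕ}

/-- Flipping the spin at `y₀` (multiplication by `Pi.mulSingle y₀ (-1)`) negates `σ_{y₀}`. [folklore] -/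
theorem spinAt_flip_self (y₀ : TorusSite d' N) (r : Layer d' N) :
    spinAt y₀ (r * Pi.mulSingle y₀ (-1)) = -spinAt y₀ r := by
  rw [spinAt_mul_cfg]
  simp [spinAt]

/-- Flipping the spin at `y₀` leaves the other spins unchanged. [folklore] -/
theorem spinAt_flip_of_ne {y₀ y : TorusSite d' N} (hy : y ≠ y₀) (r : Layer d' N) :
    spinAt y (r * Pi.mulSingle y₀ (-1)) = spinAt y r := by
  rw [spinAt_mul_cfg]
  simp [spinAt, hy]

/-- Flipping twice is the identity. [folklore] -/
theorem flip_flip (y₀ : TorusSite d' N) (r : Layer d' N) :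
    r * Pi.mulSingle y₀ (-1) * Pi.mulSingle y₀ (-1) = r := by
  rw [mul_assoc, ← Pi.mulSingle_mul, neg_mul_neg, one_mul, Pi.mulSingle_one, mul_one]

/-- `r' = F r ↔ r = F r'` (the flip `F` is an involution). [folklore] -/
theorem eq_flip_comm (y₀ : TorusSite d' N) (r r' : Layer d' N) :
    r' = r * Pi.mulSingle y₀ (-1) ↔ r = r' * Pi.mulSingle y₀ (-1) := by
  constructor
  · rintro rfl; rw [flip_flip]
  · rintro rfl; rw [flip_flip]

variable [NeZero N]

/-- The inter-layer coupling after a flip: `C(r, F r') = C(r, r') - 2 σ_{y₀}(r) σ_{y₀}(r')`. [folklore] -/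
theorem couplingEnergy_flip (y₀ : TorusSite d' N) (r r' : Layer d' N) :
    couplingEnergy r (r' * Pi.mulSingle y₀ (-1)) = couplingEnergy r r' - 2 * (spinAt y₀ r * spinAt y₀ r') := by
  classical
  have key : couplingEnergy r (r' * Pi.mulSingle y₀ (-1)) - couplingEnergy r r' =
      -(2 * (spinAt y₀ r * spinAt y₀ r')) := by
    simp only [couplingEnergy, ← Finset.sum_sub_distrib]
    rw [Finset.sum_eq_single y₀]
    · rw [spinAt_flip_self]; ring
    · intro y _ hy
      rw [spinAt_flip_of_ne hy, sub_self]
    · intro h; exact absurd (Finset.mem_univ _) h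
  linarith

/-- The coupling matrix after a flip: `K(r, F r') = K(r, r') e^{-2β σ_{y₀}(r) σ_{y₀}(r')}`. [folklore] -/
theorem couplingMatrix_flip (β : ℝ) (y₀ : TorusSite d' N) (r r' : Layer d' N) :
    couplingMatrix β r (r' * Pi.mulSingle y₀ (-1)) =
      couplingMatrix β r r' * Real.exp (-2 * β * (spinAt y₀ r * spinAt y₀ r')) := by
  rw [couplingMatrix, couplingMatrix, couplingEnergy_flip, ← Real.exp_add]
  congr 1
  ring

/-- `halfLayerWeight > 0`. [folklore] -/
theorem halfLayerWeight_pos (β h : ℝ) (r : Layer d' N) : 0 < halfLayerWeight β h r := Real.exp_pos _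

/-- The transfer matrix after a flip of the second argument, with the half-weights exchanged:
`A(r, F r') w(F r')⁻¹ w(r') = A(r, r') e^{-2β σ_{y₀}(r) σ_{y₀}(r')}`. [folklore] -/
theorem transferMatrix_flip (β : ℝ) (y₀ : TorusSite d' N) (r r' : Layer d' N) :
    transferMatrix β 0 r (r' * Pi.mulSingle y₀ (-1)) * ((halfLayerWeight β 0 (r' * Pi.mulSingle y₀ (-1)))⁻¹ *
        halfLayerWeight β 0 r') =
      transferMatrix β 0 r r' * Real.exp (-2 * β * (spinAt y₀ r * spinAt y₀ r')) := by
  have hw : halfLayerWeight β 0 (r' * Pi.mulSingle y₀ (-1)) ≠ 0 := (halfLayerWeight_pos β 0 _).ne'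
  simp only [transferMatrix, couplingMatrix_flip]
  field_simp

/-- `0 < t = e^{-2β} < 1` for `β > 0`, so `1 - t² ≠ 0`. [folklore] -/
theorem one_sub_exp_sq_pos {β : ℝ} (hβ : 0 < β) : 0 < 1 - Real.exp (-2 * β) ^ 2 := by
  have h1 : Real.exp (-2 * β) < 1 := by
    rw [← Real.exp_zero]
    exact Real.exp_lt_exp.2 (by linarith)
  have h0 : 0 < Real.exp (-2 * β) := Real.exp_pos _
  nlinarith

/-- **The intertwining relation** `diag(σ_{y₀}) · A = A · S'` for the symmetrised transfer matrix
`A` of the nearest-neighbour Ising model at `β > 0` (zero field), with the intertwiner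
`S'(r, r') = (1 - t²)⁻¹ σ_{y₀}(r) [(1 + t²) 𝟙[r' = r] + 2t w(r)⁻¹ w(r') 𝟙[r' = F r]]`, `t = e^{-2β}`,
`w = e^{βE/2}` the half layer weight, `F` the flip at `y₀`: the matrix `D⁻¹ K⁻¹ σ_{y₀} K D` computed
from the one-site identity `(1 - t²) Z k = (1 + t²) k Z + 2t k Z X` for the `2 × 2` transfer
matrix `k = e^{β}(1 + tX)`. [folklore] -/
theorem diagonal_spinAt_mul_transferMatrix {β : ℝ} (hβ : 0 < β) (y₀ : TorusSite d' N)
    {S' : Matrix (Layer d' N) (Layer d' N) ℝ}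
    (hS' : S' = Matrix.of fun r r' => (1 - Real.exp (-2 * β) ^ 2)⁻¹ * spinAt y₀ r *
      ((1 + Real.exp (-2 * β) ^ 2) * (if r' = r then 1 else 0) +
        2 * Real.exp (-2 * β) * ((halfLayerWeight β 0 r)⁻¹ * halfLayerWeight β 0 r') *
          (if r' = r * Pi.mulSingle y₀ (-1) then 1 else 0))) :
    diagonal (fun r => spinAt y₀ r) * transferMatrix β 0 = transferMatrix β 0 * S' := by
  classical
  set t : ℝ := Real.exp (-2 * β) with ht
  have ht0 : 0 < t := Real.exp_pos _
  have ht1 : 1 - t ^ 2 ≠ 0 := (one_sub_exp_sq_pos hβ).ne'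
  have ht0' : t ≠ 0 := ht0.ne'
  have htinv : Real.exp (2 * β) = t⁻¹ := by rw [ht, ← Real.exp_neg]; ring_nf
  ext r r''
  rw [Matrix.diagonal_mul, Matrix.mul_apply]
  -- split the sum over `r'` into the two delta functions
  have hsplit : ∀ r', transferMatrix β 0 r r' * S' r' r'' =
      (if r'' = r' then (1 - t ^ 2)⁻¹ * spinAt y₀ r' * (1 + t ^ 2) * transferMatrix β 0 r r' else 0) +
      (if r' = r'' * Pi.mulSingle y₀ (-1) then (1 - t ^ 2)⁻¹ * spinAt y₀ r' * (2 * t) *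
        (transferMatrix β 0 r r' * ((halfLayerWeight β 0 r')⁻¹ * halfLayerWeight β 0 r'')) else 0) := by
    intro r'
    have hiff : (r'' = r' * Pi.mulSingle y₀ (-1)) ↔ (r' = r'' * Pi.mulSingle y₀ (-1)) := eq_flip_comm y₀ r' r''
    rw [hS', Matrix.of_apply]
    by_cases h1 : r'' = r' <;> by_cases h2 : r' = r'' * Pi.mulSingle y₀ (-1)
    · rw [if_pos h1, if_pos (hiff.2 h2), if_pos h1, if_pos h2]; ring
    · rw [if_pos h1, if_neg (fun h => h2 (hiff.1 h)), if_pos h1, if_neg h2]; ring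
    · rw [if_neg h1, if_pos (hiff.2 h2), if_neg h1, if_pos h2]; ring
    · rw [if_neg h1, if_neg (fun h => h2 (hiff.1 h)), if_neg h1, if_neg h2]; ring
  simp_rw [hsplit]
  rw [Finset.sum_add_distrib, Finset.sum_ite_eq, Finset.sum_ite_eq', if_pos (Finset.mem_univ _),
    if_pos (Finset.mem_univ _), spinAt_flip_self, transferMatrix_flip]
  -- case analysis on the two spins
  set a := transferMatrix β 0 r r'' with ha
  rcases spinAt_eq_one_or_eq_neg_one y₀ r with h | h <;>
    rcases spinAt_eq_one_or_eq_neg_one y₀ r'' with h' | h'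
  · have he : Real.exp (-2 * β * (1 * 1)) = t := by rw [ht]; ring_nf
    rw [h, h', he]; field_simp; ring
  · have he : Real.exp (-2 * β * (1 * -1)) = t⁻¹ := by rw [← htinv]; ring_nf
    rw [h, h', he]; field_simp; ring
  · have he : Real.exp (-2 * β * (-1 * 1)) = t⁻¹ := by rw [← htinv]; ring_nf
    rw [h, h', he]; field_simp; ring
  · have he : Real.exp (-2 * β * (-1 * -1)) = t := by rw [ht]; ring_nf
    rw [h, h', he]; field_simp; ring

/-! #### The uniform bound on the intertwiner -/

omit [NeZero N] in
/-- A product of two spins lies in `[-1, 1]`. [folklore] -/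
theorem abs_spinAt_mul_spinAt_le (a b : TorusSite d' N) (ρ : Layer d' N) : |spinAt a ρ * spinAt b ρ| ≤ 1 := by
  rcases spinAt_eq_one_or_eq_neg_one a ρ with h | h <;>
    rcases spinAt_eq_one_or_eq_neg_one b ρ with h' | h' <;> simp [h, h']

/-- **A single spin flip changes the intra-layer energy by at most `4d'`** (only the `≤ 2d'` bonds
at `y₀` change, each by at most `2`). [folklore] -/
theorem layerEnergy_flip_sub_le (y₀ : TorusSite d' N) (r : Layer d' N) :
    layerEnergy 0 (r * Pi.mulSingle y₀ (-1)) - layerEnergy 0 r ≤ 4 * d' := by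
  classical
  set r' : Layer d' N := r * Pi.mulSingle y₀ (-1) with hr'
  have hE : ∀ ρ : Layer d' N, layerEnergy 0 ρ = ∑ j : Fin d', ∑ y, spinAt y ρ * spinAt (y + Pi.single j 1) ρ := by
    intro ρ; rw [layerEnergy, zero_mul, add_zero, Finset.sum_comm]
  rw [hE, hE, ← Finset.sum_sub_distrib]
  calc ∑ j : Fin d', (∑ y, spinAt y r' * spinAt (y + Pi.single j 1) r' -
        ∑ y, spinAt y r * spinAt (y + Pi.single j 1) r)
      ≤ ∑ _j : Fin d', (4 : ℝ) := Finset.sum_le_sum fun j _ => ?_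
    _ = 4 * d' := by simp [mul_comm]
  rw [← Finset.sum_sub_distrib]
  set s : TorusSite d' N → ℝ := fun y => spinAt y r' * spinAt (y + Pi.single j 1) r' -
    spinAt y r * spinAt (y + Pi.single j 1) r with hs
  have hvanish : ∀ y, y ≠ y₀ → y + Pi.single j 1 ≠ y₀ → s y = 0 := by
    intro y hy hy'
    simp only [hs, hr', spinAt_flip_of_ne hy, spinAt_flip_of_ne hy', sub_self]
  have habs : ∀ y, s y ≤ 2 := by
    intro y
    have h1 := abs_spinAt_mul_spinAt_le y (y + Pi.single j 1) r'
    have h2 := abs_spinAt_mul_spinAt_le y (y + Pi.single j 1) r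
    rw [abs_le] at h1 h2
    simp only [hs]
    linarith [h1.2, h2.1]
  set T : Finset (TorusSite d' N) := Finset.univ.filter (fun y => y = y₀ ∨ y + Pi.single j 1 = y₀) with hT
  have hsum : ∑ y ∈ T, s y = ∑ y, s y := by
    refine Finset.sum_filter_of_ne fun y _ hne => ?_
    by_contra hcon
    rw [not_or] at hcon
    exact hne (hvanish y hcon.1 hcon.2)
  have hcard : T.card ≤ 2 := by
    have hsub : T ⊆ {y₀, y₀ - Pi.single j 1} := by
      intro y hy
      rw [hT, Finset.mem_filter] at hy
      rcases hy.2 with h | h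
      · simp [h]
      · simp [eq_sub_of_add_eq h]
    exact (Finset.card_le_card hsub).trans Finset.card_le_two
  show ∑ y, s y ≤ 4
  rw [← hsum]
  calc ∑ y ∈ T, s y ≤ ∑ _y ∈ T, (2 : ℝ) := Finset.sum_le_sum fun y _ => habs y
    _ = 2 * T.card := by rw [Finset.sum_const, nsmul_eq_mul, mul_comm]
    _ ≤ 2 * 2 := by gcongr; exact_mod_cast hcard
    _ = 4 := by norm_num

/-- The ratio of half layer weights across a flip is at most `e^{2βd'}` (for `β ≥ 0`). [folklore] -/
theorem halfLayerWeight_ratio_le {β : ℝ} (hβ : 0 ≤ β) (y₀ : TorusSite d' N) (r : Layer d' N) :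
    (halfLayerWeight β 0 r)⁻¹ * halfLayerWeight β 0 (r * Pi.mulSingle y₀ (-1)) ≤ Real.exp (2 * β * d') := by
  rw [halfLayerWeight, halfLayerWeight, ← Real.exp_neg, ← Real.exp_add]
  apply Real.exp_le_exp.2
  have h := layerEnergy_flip_sub_le y₀ r
  have h2 : β * (layerEnergy 0 (r * Pi.mulSingle y₀ (-1)) - layerEnergy 0 r) ≤ β * (4 * d') :=
    mul_le_mul_of_nonneg_left h hβ
  linarith

/-- The ratio of half layer weights is positive. [folklore] -/
theorem halfLayerWeight_ratio_nonneg (β : ℝ) (r r' : Layer d' N) :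
    0 ≤ (halfLayerWeight β 0 r)⁻¹ * halfLayerWeight β 0 r' :=
  mul_nonneg (inv_nonneg.2 (halfLayerWeight_pos β 0 r).le) (halfLayerWeight_pos β 0 _).le

/-- **The uniform bound on the intertwiner**: with `t = e^{-2β}` and
`B(β, d') = 2[(1+t²)² + 4t² e^{4βd'}]/(1-t²)²`, `‖S'v‖² ≤ B ‖v‖²` — uniformly in the size `N`
of the layer (one flip changes the intra-layer energy by `≤ 4d'`). [folklore] -/
theorem sum_sq_intertwiner_mulVec_le {β : ℝ} (hβ : 0 < β) (y₀ : TorusSite d' N)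
    {S' : Matrix (Layer d' N) (Layer d' N) ℝ}
    (hS' : S' = Matrix.of fun r r' => (1 - Real.exp (-2 * β) ^ 2)⁻¹ * spinAt y₀ r *
      ((1 + Real.exp (-2 * β) ^ 2) * (if r' = r then 1 else 0) +
        2 * Real.exp (-2 * β) * ((halfLayerWeight β 0 r)⁻¹ * halfLayerWeight β 0 r') *
          (if r' = r * Pi.mulSingle y₀ (-1) then 1 else 0)))
    (v : Layer d' N → ℝ) :
    ∑ r, (S' *ᵥ v) r ^ 2 ≤
      (2 * ((1 + Real.exp (-2 * β) ^ 2) ^ 2 + 4 * Real.exp (-2 * β) ^ 2 * Real.exp (2 * β * d') ^ 2) /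
        (1 - Real.exp (-2 * β) ^ 2) ^ 2) * ∑ r, v r ^ 2 := by
  classical
  set t : ℝ := Real.exp (-2 * β) with ht
  set R : ℝ := Real.exp (2 * β * d') with hR
  set m : Layer d' N := Pi.mulSingle y₀ (-1) with hm
  have hden : 0 < 1 - t ^ 2 := one_sub_exp_sq_pos hβ
  have ht0 : 0 < t := Real.exp_pos _
  -- the action of `S'` on a vector
  have hmulVec : ∀ r, (S' *ᵥ v) r = (1 - t ^ 2)⁻¹ * spinAt y₀ r *
      ((1 + t ^ 2) * v r + 2 * t * ((halfLayerWeight β 0 r)⁻¹ * halfLayerWeight β 0 (r * m)) * v (r * m)) := by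
    intro r
    simp only [Matrix.mulVec, dotProduct]
    have hsplit : ∀ r', S' r r' * v r' =
        (if r' = r then (1 - t ^ 2)⁻¹ * spinAt y₀ r * (1 + t ^ 2) * v r' else 0) +
        (if r' = r * m then (1 - t ^ 2)⁻¹ * spinAt y₀ r * (2 * t) *
          ((halfLayerWeight β 0 r)⁻¹ * halfLayerWeight β 0 r') * v r' else 0) := by
      intro r'
      rw [hS', Matrix.of_apply]
      by_cases h1 : r' = r <;> by_cases h2 : r' = r * m
      · rw [if_pos h1, if_pos h2, if_pos h1, if_pos h2]; ring
      · rw [if_pos h1, if_neg h2, if_pos h1, if_neg h2]; ring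
      · rw [if_neg h1, if_pos h2, if_neg h1, if_pos h2]; ring
      · rw [if_neg h1, if_neg h2, if_neg h1, if_neg h2]; ring
    simp_rw [hsplit]
    rw [Finset.sum_add_distrib, Finset.sum_ite_eq', Finset.sum_ite_eq', if_pos (Finset.mem_univ _),
      if_pos (Finset.mem_univ _)]
    ring
  -- termwise bound
  have hterm : ∀ r, (S' *ᵥ v) r ^ 2 ≤
      2 / (1 - t ^ 2) ^ 2 * ((1 + t ^ 2) ^ 2 * v r ^ 2 + 4 * t ^ 2 * R ^ 2 * v (r * m) ^ 2) := by
    intro r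
    set ρ : ℝ := (halfLayerWeight β 0 r)⁻¹ * halfLayerWeight β 0 (r * m) with hρ
    have hρ0 : 0 ≤ ρ := halfLayerWeight_ratio_nonneg β r (r * m)
    have hρR : ρ ≤ R := halfLayerWeight_ratio_le hβ.le y₀ r
    have hρ2 : ρ ^ 2 ≤ R ^ 2 := pow_le_pow_left₀ hρ0 hρR 2
    set a : ℝ := (1 + t ^ 2) * v r with ha
    set b : ℝ := 2 * t * ρ * v (r * m) with hb
    have hform : (S' *ᵥ v) r = (1 - t ^ 2)⁻¹ * spinAt y₀ r * (a + b) := by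
      rw [hmulVec]
    have hs2 : spinAt y₀ r ^ 2 = 1 := spinAt_sq y₀ r
    have hsq : (S' *ᵥ v) r ^ 2 = (a + b) ^ 2 / (1 - t ^ 2) ^ 2 := by
      rw [hform]
      field_simp
      rw [hs2, one_mul]
    rw [hsq, div_mul_eq_mul_div, div_le_div_iff_of_pos_right (pow_pos hden 2)]
    have hab : (a + b) ^ 2 ≤ 2 * (a ^ 2 + b ^ 2) := by nlinarith [sq_nonneg (a - b)]
    have hb2 : b ^ 2 ≤ 4 * t ^ 2 * R ^ 2 * v (r * m) ^ 2 := by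
      rw [hb]
      have : (2 * t * ρ * v (r * m)) ^ 2 = 4 * t ^ 2 * v (r * m) ^ 2 * ρ ^ 2 := by ring
      rw [this]
      calc 4 * t ^ 2 * v (r * m) ^ 2 * ρ ^ 2 ≤ 4 * t ^ 2 * v (r * m) ^ 2 * R ^ 2 := by
            gcongr
        _ = _ := by ring
    have ha2 : a ^ 2 = (1 + t ^ 2) ^ 2 * v r ^ 2 := by rw [ha]; ring
    nlinarith [hab, hb2, ha2]
  -- sum, and reindex the flipped sum
  have hflipsum : ∑ r, v (r * m) ^ 2 = ∑ r, v r ^ 2 := by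
    simpa using Equiv.sum_comp (Equiv.mulRight m) (fun r => v r ^ 2)
  calc ∑ r, (S' *ᵥ v) r ^ 2
      ≤ ∑ r, 2 / (1 - t ^ 2) ^ 2 * ((1 + t ^ 2) ^ 2 * v r ^ 2 + 4 * t ^ 2 * R ^ 2 * v (r * m) ^ 2) :=
        Finset.sum_le_sum fun r _ => hterm r
    _ = 2 / (1 - t ^ 2) ^ 2 * ((1 + t ^ 2) ^ 2 * ∑ r, v r ^ 2 + 4 * t ^ 2 * R ^ 2 * ∑ r, v r ^ 2) := by
        rw [← Finset.mul_sum, Finset.sum_add_distrib, ← Finset.mul_sum, ← Finset.mul_sum, hflipsum]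
    _ = (2 * ((1 + t ^ 2) ^ 2 + 4 * t ^ 2 * R ^ 2) / (1 - t ^ 2) ^ 2) * ∑ r, v r ^ 2 := by
        ring

/-- **Existence of a uniformly bounded intertwiner** `σ_{y₀} A = A S'`, `‖S'v‖² ≤ B(β,d') ‖v‖²`,
for the symmetrised Ising transfer matrix at `β > 0`. [folklore] -/
theorem exists_intertwiner {β : ℝ} (hβ : 0 < β) (y₀ : TorusSite d' N) :
    ∃ S' : Matrix (Layer d' N) (Layer d' N) ℝ,
      diagonal (fun r => spinAt y₀ r) * transferMatrix β 0 = transferMatrix β 0 * S' ∧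
      ∀ v : Layer d' N → ℝ, ∑ r, (S' *ᵥ v) r ^ 2 ≤
        (2 * ((1 + Real.exp (-2 * β) ^ 2) ^ 2 + 4 * Real.exp (-2 * β) ^ 2 * Real.exp (2 * β * d') ^ 2) /
          (1 - Real.exp (-2 * β) ^ 2) ^ 2) * ∑ r, v r ^ 2 :=
  ⟨_, diagonal_spinAt_mul_transferMatrix hβ y₀ rfl, sum_sq_intertwiner_mulVec_le hβ y₀ rfl⟩

end Intertwiner

/-! ### Part C. The finite-volume spectral measure of the axis two-point function on the torus -/

section Torus

open Matrix Finset _root_.MeasureTheory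

/-- Every function is integrable against a Dirac mass on `ℝ`. [folklore] -/
theorem integrable_dirac_real (g : ℝ → ℝ) (a : ℝ) : Integrable g (Measure.dirac a) :=
  (integrable_const (g a)).congr (ae_eq_dirac g).symm

/-- **The finite-volume spectral representation with the no-atom bound** (the content of ADC 2021,
App. 8.3, eq. (212) and "the positivity of the transfer matrix", on the tori `(ℤ/Nℤ)^{d'+1}`,
`N ≥ 3`, `β > 0`, plus the intertwiner estimate of Part B): there is `B = B(β, d') ≥ 0` such that
for every `N ≥ 3` and axis `i` there is a finitely supported positive measure
`ν_N = ∑_{k,l} (c_{kl} λ_k^N / Z) δ_{λ_l/λ_k}` on `[0, ∞)` with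
`⟨σ₀ σ_{n e_i}⟩_{𝕋_N;β} = ∫ λⁿ dν_N(λ)` for `0 ≤ n < N` and `ν_N([0, δ]) ≤ B δ²` for all `δ ≥ 0`.
[cite: AizenmanDuminilCopinAnnals2021, Appendix §8.3, proof of Prop. 8.6, eq. (212)–(101)] -/
theorem exists_torusAxisMeasure {β : ℝ} (hβ : 0 < β) (d' : ℕ) :
    ∃ B : ℝ, 0 ≤ B ∧ ∀ (N : ℕ) [NeZero N], 3 ≤ N → ∀ i : Fin (d' + 1),
      ∃ ν : Measure ℝ, IsFiniteMeasure ν ∧ ν (Set.Iio 0) = 0 ∧ (∀ n : ℕ, Integrable (fun x : ℝ => x ^ n) ν) ∧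
        (∀ n : ℕ, n < N → ∫ x, x ^ n ∂ν = isingTorusTwoPoint (d' + 1) N β 0 0 (Pi.single i (n : ZMod N))) ∧
        ∀ δ : ℝ, 0 ≤ δ → ν (Set.Icc 0 δ) ≤ ENNReal.ofReal (B * δ ^ 2) := by
  set B : ℝ := (2 * ((1 + Real.exp (-2 * β) ^ 2) ^ 2 + 4 * Real.exp (-2 * β) ^ 2 * Real.exp (2 * β * d') ^ 2) /
    (1 - Real.exp (-2 * β) ^ 2) ^ 2) with hBdef
  refine ⟨B, by positivity, fun N _ hN i => ?_⟩
  classical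
  set y₀ : TorusSite d' N := i.removeNth (0 : TorusSite (d' + 1) N) with hy₀
  set A := transferMatrix (d' := d') (N := N) β 0 with hAdef
  have hA : A.PosSemidef := transferMatrix_posSemidef hβ.le 0
  set f : Layer d' N → ℝ := fun r => spinAt y₀ r with hf
  obtain ⟨S', hS, hSB⟩ := exists_intertwiner (N := N) hβ y₀
  obtain ⟨ev, c, c', hev, hc, hc', htrace, htrpow, hrel, hsumc'⟩ :=
    exists_spectralWeights_of_intertwiner hA f S' hS B hSB
  -- the partition function and the two-point function as two-insertion traces
  set Z := isingPartitionFunction (torusGraph (d' + 1) N) Finset.univ β 0 .free with hZdef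
  have hZpos : 0 < Z := isingPartitionFunction_pos _ _ β 0 _
  set u : ZMod N → ℝ := fun n => isingTorusTwoPoint (d' + 1) N β 0 0 (Pi.single i n) with hu
  have hZu : ∀ n : ZMod N, Z * u n = ∑ k, ∑ l, c k l * (ev l ^ n.val * ev k ^ (N - n.val)) := by
    intro n
    have key := Z_mul_torusAxisForm_eq_trace hN β i (fun _ : Fin 1 => (1 : ℝ))
      (fun _ => (0 : TorusSite (d' + 1) N)) (fun _ => rfl) n
    have hform : torusAxisForm β i (fun _ : Fin 1 => (1 : ℝ)) (fun _ => (0 : TorusSite (d' + 1) N)) n = u n := by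
      simp [torusAxisForm, hu]
    have hdiag : (diagonal fun r : Layer d' N =>
        ∑ a : Fin 1, (1 : ℝ) * spinAt (i.removeNth ((fun _ : Fin 1 => (0 : TorusSite (d' + 1) N)) a)) r) =
        diagonal f := by
      congr 1; funext r; simp [hf, hy₀]
    rw [hform, hdiag] at key
    rw [key]
    exact htrace n.val (N - n.val)
  have hu0 : u 0 = 1 := by simp [hu, isingTorusTwoPoint]
  have hZev : Z = ∑ k, ev k ^ N := by
    have h := hZu 0
    rw [hu0, mul_one, ZMod.val_zero, Nat.sub_zero] at h
    have h2 : (diagonal f * A ^ 0 * diagonal f * A ^ N).trace = (A ^ N).trace := by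
      rw [pow_zero, Matrix.mul_one, diagonal_mul_diagonal]
      have : (fun r => f r * f r) = fun _ => (1 : ℝ) := funext fun r => spinAt_mul_self y₀ r
      rw [this, diagonal_one, Matrix.one_mul]
    rw [h, ← htrace 0 N, h2, htrpow N]
  -- weights and atoms of the spectral measure
  set w : Layer d' N → Layer d' N → ℝ := fun k l => c k l * ev k ^ N / Z with hw
  set x : Layer d' N → Layer d' N → ℝ := fun k l => ev l / ev k with hx
  have hw0 : ∀ k l, 0 ≤ w k l := fun k l => div_nonneg (mul_nonneg (hc k l) (pow_nonneg (hev k) N)) hZpos.le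
  have hx0 : ∀ k l, 0 ≤ x k l := fun k l => div_nonneg (hev l) (hev k)
  let ν : Measure ℝ := ∑ p : Layer d' N × Layer d' N, ENNReal.ofReal (w p.1 p.2) • Measure.dirac (x p.1 p.2)
  have hνapply : ∀ s : Set ℝ, MeasurableSet s →
      ν s = ∑ p : Layer d' N × Layer d' N, ENNReal.ofReal (w p.1 p.2) * s.indicator 1 (x p.1 p.2) := by
    intro s hs
    simp only [ν, Measure.coe_finsetSum, Finset.sum_apply, Measure.smul_apply, smul_eq_mul,
      Measure.dirac_apply' _ hs]
  have hint : ∀ g : ℝ → ℝ, Integrable g ν := fun g =>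
    integrable_finsetSum_measure.2 fun p _ => (integrable_dirac_real g _).smul_measure ENNReal.ofReal_ne_top
  have hintegral : ∀ g : ℝ → ℝ, ∫ t, g t ∂ν = ∑ p : Layer d' N × Layer d' N, w p.1 p.2 * g (x p.1 p.2) := by
    intro g
    rw [integral_finsetSum_measure fun p _ => (integrable_dirac_real g _).smul_measure ENNReal.ofReal_ne_top]
    refine Finset.sum_congr rfl fun p _ => ?_
    rw [integral_smul_measure, integral_dirac, ENNReal.toReal_ofReal (hw0 _ _), smul_eq_mul]
  refine ⟨ν, ?_, ?_, fun n => hint _, fun n hn => ?_, fun δ hδ => ?_⟩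
  · -- finite
    refine ⟨?_⟩
    rw [hνapply _ MeasurableSet.univ]
    exact ENNReal.sum_lt_top.2 fun p _ => ENNReal.mul_lt_top ENNReal.ofReal_lt_top (by simp)
  · -- no mass below `0`
    rw [hνapply _ measurableSet_Iio]
    refine Finset.sum_eq_zero fun p _ => ?_
    rw [Set.indicator_of_notMem (by simpa using hx0 p.1 p.2), mul_zero]
  · -- moments `0 ≤ n < N`
    rw [hintegral, Fintype.sum_prod_type]
    have hval : (n : ZMod N).val = n := ZMod.val_cast_of_lt hn
    have key := hZu n
    rw [hval] at key
    have hterm : ∀ k l, w k l * x k l ^ n = Z⁻¹ * (c k l * (ev l ^ n * ev k ^ (N - n))) := by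
      intro k l
      simp only [hw, hx]
      rcases (hev k).eq_or_lt with hk | hk
      · rw [← hk, zero_pow (by omega : N ≠ 0), zero_pow (by omega : N - n ≠ 0)]; simp
      · rw [div_pow]
        have hsplit : ev k ^ N = ev k ^ n * ev k ^ (N - n) := by rw [← pow_add]; congr 1; omega
        rw [hsplit]
        field_simp
    simp_rw [hterm, ← Finset.mul_sum]
    rw [← key]
    field_simp
    rfl
  · -- the no-atom bound `ν([0, δ]) ≤ B δ²`
    rw [hνapply _ measurableSet_Icc]
    have hbound : ∀ p : Layer d' N × Layer d' N,
        ENNReal.ofReal (w p.1 p.2) * (Set.Icc 0 δ).indicator 1 (x p.1 p.2) ≤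
          ENNReal.ofReal (δ ^ 2 * (c' p.1 p.2 * ev p.1 ^ N / Z)) := by
      rintro ⟨k, l⟩
      by_cases hmem : x k l ∈ Set.Icc 0 δ
      · rw [Set.indicator_of_mem hmem, Pi.one_apply, mul_one]
        refine ENNReal.ofReal_le_ofReal ?_
        show c k l * ev k ^ N / Z ≤ δ ^ 2 * (c' k l * ev k ^ N / Z)
        rcases (hev k).eq_or_lt with hk | hk
        · rw [← hk, zero_pow (by omega : N ≠ 0)]; simp
        · have hckl : c k l = x k l ^ 2 * c' k l := by
            have h := hrel k l
            simp only [hx]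
            field_simp
            linarith [h]
          have hxδ : x k l ^ 2 ≤ δ ^ 2 := pow_le_pow_left₀ hmem.1 hmem.2 2
          calc c k l * ev k ^ N / Z = x k l ^ 2 * (c' k l * ev k ^ N / Z) := by rw [hckl]; ring
            _ ≤ δ ^ 2 * (c' k l * ev k ^ N / Z) :=
                mul_le_mul_of_nonneg_right hxδ
                  (div_nonneg (mul_nonneg (hc' k l) (pow_nonneg (hev k) N)) hZpos.le)
      · rw [Set.indicator_of_notMem hmem, mul_zero]; exact zero_le
    have hnn : ∀ p : Layer d' N × Layer d' N, 0 ≤ δ ^ 2 * (c' p.1 p.2 * ev p.1 ^ N / Z) := fun p =>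
      mul_nonneg (sq_nonneg δ) (div_nonneg (mul_nonneg (hc' _ _) (pow_nonneg (hev _) N)) hZpos.le)
    calc ∑ p : Layer d' N × Layer d' N, ENNReal.ofReal (w p.1 p.2) * (Set.Icc 0 δ).indicator 1 (x p.1 p.2)
        ≤ ∑ p : Layer d' N × Layer d' N, ENNReal.ofReal (δ ^ 2 * (c' p.1 p.2 * ev p.1 ^ N / Z)) :=
          Finset.sum_le_sum fun p _ => hbound p
      _ = ENNReal.ofReal (∑ p : Layer d' N × Layer d' N, δ ^ 2 * (c' p.1 p.2 * ev p.1 ^ N / Z)) :=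
          (ENNReal.ofReal_sum_of_nonneg fun p _ => hnn p).symm
      _ ≤ ENNReal.ofReal (B * δ ^ 2) := ENNReal.ofReal_le_ofReal ?_
    rw [Fintype.sum_prod_type]
    calc ∑ k, ∑ l, δ ^ 2 * (c' k l * ev k ^ N / Z) = δ ^ 2 * ∑ k, (ev k ^ N / Z) * ∑ l, c' k l := by
          rw [Finset.mul_sum]
          refine Finset.sum_congr rfl fun k _ => ?_
          rw [Finset.mul_sum, Finset.mul_sum]
          refine Finset.sum_congr rfl fun l _ => ?_
          ring
      _ ≤ δ ^ 2 * ∑ k, (ev k ^ N / Z) * B := by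
          gcongr with k _
          · exact div_nonneg (pow_nonneg (hev k) N) hZpos.le
          · exact hsumc' k
      _ = B * δ ^ 2 := by
          rw [← Finset.sum_mul, ← Finset.sum_div, ← hZev, div_self hZpos.ne']
          ring

end Torus

/-! ### Part D. The limit: from approximate Hausdorff moment sequences to a Laplace transform -/

section Limit

open _root_.MeasureTheory _root_.Filter _root_.Set _root_.BoundedContinuousFunction
open scoped _root_.Topology

/-- Truncated powers as bounded continuous functions: some `g ∈ C_b(ℝ)` agrees with `xⁿ` on
`[0, 2]` (namely `(max 0 (min x 2))ⁿ`). [folklore] -/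
theorem exists_bcf_eq_pow (n : ℕ) : ∃ g : ℝ →ᵇ ℝ, ∀ x ∈ Icc (0 : ℝ) 2, g x = x ^ n := by
  refine ⟨BoundedContinuousFunction.ofNormedAddCommGroup (fun x => (max 0 (min x 2)) ^ n)
    ((continuous_const.max (continuous_id.min continuous_const)).pow n) (2 ^ n) fun x => ?_, fun x hx => ?_⟩
  · have h0 : 0 ≤ max 0 (min x 2) := le_max_left _ _
    have h2 : max 0 (min x 2) ≤ 2 := max_le (by norm_num) (min_le_right _ _)
    rw [Real.norm_eq_abs, abs_pow, abs_of_nonneg h0]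
    exact pow_le_pow_left₀ h0 h2 n
  · simp only [BoundedContinuousFunction.coe_ofNormedAddCommGroup]
    rw [min_eq_left hx.2, max_eq_right hx.1]

/-- Tents as bounded continuous functions: for `δ > 0` some `g ∈ C_b(ℝ)` (namely
`max 0 (1 - |x|/δ)`) satisfies `𝟙_{{0}} ≤ g ≤ 𝟙_{[-δ, δ]}`. [folklore] -/
theorem exists_bcf_tent {δ : ℝ} (hδ : 0 < δ) : ∃ g : ℝ →ᵇ ℝ, ∀ x : ℝ,
    ({0} : Set ℝ).indicator (1 : ℝ → ℝ) x ≤ g x ∧ g x ≤ (Icc (-δ) δ).indicator (1 : ℝ → ℝ) x := by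
  refine ⟨BoundedContinuousFunction.ofNormedAddCommGroup (fun x => max 0 (1 - |x| / δ))
    (continuous_const.max (continuous_const.sub (continuous_abs.div_const δ))) 1 fun x => ?_, fun x => ?_⟩
  · have h0 : 0 ≤ max 0 (1 - |x| / δ) := le_max_left _ _
    have h1 : max 0 (1 - |x| / δ) ≤ 1 := max_le zero_le_one (by
      have : 0 ≤ |x| / δ := div_nonneg (abs_nonneg x) hδ.le
      linarith)
    rw [Real.norm_eq_abs, abs_of_nonneg h0]
    exact h1
  simp only [BoundedContinuousFunction.coe_ofNormedAddCommGroup]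
  constructor
  · by_cases hx : x = 0
    · subst hx; simp
    · rw [indicator_of_notMem (by simpa using hx)]
      exact le_max_left _ _
  · by_cases hx : x ∈ Icc (-δ) δ
    · rw [indicator_of_mem hx, Pi.one_apply]
      refine max_le zero_le_one ?_
      have : 0 ≤ |x| / δ := div_nonneg (abs_nonneg x) hδ.le
      linarith
    · rw [indicator_of_notMem hx]
      refine max_le le_rfl ?_
      have hx' : δ ≤ |x| := by
        rw [mem_Icc, not_and_or, not_le, not_le] at hx
        rcases hx with h | h
        · rw [abs_of_neg (by linarith)]; linarith
        · rw [abs_of_pos (by linarith)]; linarith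
      have : 1 ≤ |x| / δ := by rw [le_div_iff₀ hδ, one_mul]; exact hx'
      linarith

/-- A real cluster point of a convergent sequence is its limit. [folklore] -/
theorem eq_of_mapClusterPt_of_tendsto {a : ℕ → ℝ} {y L : ℝ} (hy : MapClusterPt y atTop a)
    (hL : Tendsto a atTop (𝓝 L)) : y = L :=
  eq_of_nhds_neBot (hy.clusterPt.mono hL)

/-- A real cluster point of a sequence bounded above by `b` is `≤ b`. [folklore] -/
theorem le_of_mapClusterPt_of_le {a : ℕ → ℝ} {y b : ℝ} (hy : MapClusterPt y atTop a) (h : ∀ j, a j ≤ b) :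
    y ≤ b :=
  isClosed_Iic.mem_of_mapClusterPt hy (Eventually.of_forall h)

/-- **From approximately-Hausdorff moment data to a Laplace transform.** Let `ν_j` be finite positive
measures on `[0, ∞)` whose moments of order `n ≤ j` are at most `1` and converge, `∫ λⁿ dν_j → u(n)`,
and which put mass `≤ B δ²` on `[0, δ]` uniformly in `j`. Then `u(n) = ∫ e^{-an} dμ(a)` for a finite
positive measure `μ` on `[0, ∞)` (all `n ∈ ℕ`, including `n = 0`). Proof: restrict to `[0, 2]` (the
tails are `≤ 2^{n-j}`), take a weak cluster point (Prokhorov / Riesz–Markov, Mathlib), read off the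
moments, use `u(n) ≤ 1` to kill `(1, 2]` and the uniform bound to kill the atom at `0`, and change
variables `λ = e^{-a}`. This is "the moment criterion for the convergence of positive measures over
bounded intervals" of the printed proof, with the atom at `λ = 0` (i.e. `a = ∞`) excluded.
[cite: AizenmanDuminilCopinAnnals2021, Appendix §8.3, proof of Prop. 8.6 (last paragraph)] -/
theorem exists_laplace_of_momentLimit (u : ℕ → ℝ) (ν : ℕ → Measure ℝ) (hfin : ∀ j, IsFiniteMeasure (ν j))
    {B : ℝ} (hB : 0 ≤ B)
    (hsupp : ∀ j, ν j (Iio 0) = 0)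
    (hint : ∀ j n, Integrable (fun x : ℝ => x ^ n) (ν j))
    (hle : ∀ j n, n ≤ j → ∫ x, x ^ n ∂(ν j) ≤ 1)
    (hlim : ∀ n, Tendsto (fun j => ∫ x, x ^ n ∂(ν j)) atTop (𝓝 (u n)))
    (hzero : ∀ j δ, 0 ≤ δ → ν j (Icc 0 δ) ≤ ENNReal.ofReal (B * δ ^ 2)) :
    ∃ μ : Measure ℝ, IsFiniteMeasure μ ∧ μ (Ici 0)ᶜ = 0 ∧
      ∀ n : ℕ, u n = ∫ a, Real.exp (-(a * n)) ∂μ := by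
  classical
  set K : Set ℝ := Icc 0 2 with hKdef
  have hK : IsCompact K := isCompact_Icc
  have hKm : MeasurableSet K := measurableSet_Icc
  have hae0 : ∀ j, ∀ᵐ x ∂(ν j), 0 ≤ x := fun j =>
    (measure_eq_zero_iff_ae_notMem.1 (hsupp j)).mono fun x hx => not_lt.1 hx
  have hu1 : ∀ n, u n ≤ 1 := fun n =>
    le_of_tendsto (hlim n) (eventually_atTop.2 ⟨n, fun j hj => hle j n hj⟩)
  /- Step 1: the truncated moments converge: `∫_K λⁿ dν_j → u(n)` (tail `≤ 2^{n-j}`). -/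
  have htail : ∀ n j, n ≤ j → 0 ≤ ∫ x in Kᶜ, x ^ n ∂(ν j) ∧ ∫ x in Kᶜ, x ^ n ∂(ν j) ≤ (1 / 2) ^ (j - n) := by
    intro n j hnj
    haveI := hfin j
    have haeK : ∀ᵐ x ∂(ν j).restrict Kᶜ, 2 < x := by
      filter_upwards [ae_restrict_mem hKm.compl, ae_restrict_of_ae (hae0 j)] with x hx hx0
      simp only [hKdef, mem_compl_iff, mem_Icc, not_and_or, not_le] at hx
      rcases hx with hx | hx
      · exact absurd hx0 (not_le.2 hx)
      · exact hx
    have hpt : ∀ x : ℝ, 2 < x → 0 ≤ x ^ n ∧ x ^ n ≤ x ^ j * (1 / 2) ^ (j - n) := by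
      intro x hx
      have hx0 : 0 ≤ x := by linarith
      refine ⟨pow_nonneg hx0 n, ?_⟩
      have h2 : (2 : ℝ) ^ (j - n) ≤ x ^ (j - n) := pow_le_pow_left₀ (by norm_num) hx.le _
      have hxj : x ^ j = x ^ n * x ^ (j - n) := by rw [← pow_add]; congr 1; omega
      rw [hxj, one_div_pow, mul_one_div, le_div_iff₀ (pow_pos (by norm_num : (0 : ℝ) < 2) _)]
      exact mul_le_mul_of_nonneg_left h2 (pow_nonneg hx0 n)
    constructor
    · exact integral_nonneg_of_ae (haeK.mono fun x hx => (hpt x hx).1)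
    · calc ∫ x in Kᶜ, x ^ n ∂(ν j) ≤ ∫ x in Kᶜ, x ^ j * (1 / 2) ^ (j - n) ∂(ν j) :=
            integral_mono_ae (hint j n).integrableOn ((hint j j).mul_const _).integrableOn
              (haeK.mono fun x hx => (hpt x hx).2)
        _ = (∫ x in Kᶜ, x ^ j ∂(ν j)) * (1 / 2) ^ (j - n) := integral_mul_const _ _
        _ ≤ (∫ x, x ^ j ∂(ν j)) * (1 / 2) ^ (j - n) := by
            refine mul_le_mul_of_nonneg_right ?_ (pow_nonneg (by norm_num) _)
            exact setIntegral_le_integral (hint j j) ((hae0 j).mono fun x hx => pow_nonneg hx j)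
        _ ≤ 1 * (1 / 2) ^ (j - n) := mul_le_mul_of_nonneg_right (hle j j le_rfl) (pow_nonneg (by norm_num) _)
        _ = (1 / 2) ^ (j - n) := one_mul _
  have htrunc : ∀ n, Tendsto (fun j => ∫ x in K, x ^ n ∂(ν j)) atTop (𝓝 (u n)) := by
    intro n
    have hsplit : ∀ j, ∫ x in K, x ^ n ∂(ν j) = ∫ x, x ^ n ∂(ν j) - ∫ x in Kᶜ, x ^ n ∂(ν j) := by
      intro j
      rw [← integral_add_compl hKm (hint j n)]
      ring
    simp_rw [hsplit]
    rw [← sub_zero (u n)]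
    refine (hlim n).sub ?_
    have hgeom : Tendsto (fun j : ℕ => (1 / 2 : ℝ) ^ (j - n)) atTop (𝓝 0) :=
      (tendsto_pow_atTop_nhds_zero_of_lt_one (by norm_num) (by norm_num)).comp (tendsto_sub_atTop_nat n)
    refine tendsto_of_tendsto_of_tendsto_of_le_of_le' tendsto_const_nhds hgeom ?_ ?_
    · exact eventually_atTop.2 ⟨n, fun j hj => (htail n j hj).1⟩
    · exact eventually_atTop.2 ⟨n, fun j hj => (htail n j hj).2⟩
  /- Step 2: a weak cluster point `ν̄` of the restrictions to `K` (compactness, Mathlib's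
  `isCompact_setOf_finiteMeasure_le_of_isCompact`). -/
  let ρ : ℕ → FiniteMeasure ℝ := fun j => ⟨(ν j).restrict K, by haveI := hfin j; infer_instance⟩
  have hρcoe : ∀ j, ((ρ j : FiniteMeasure ℝ) : Measure ℝ) = (ν j).restrict K := fun j => rfl
  set S : Set (FiniteMeasure ℝ) := {μ | μ.mass ≤ 1 ∧ μ Kᶜ = 0} with hSdef
  have hS : IsCompact S := isCompact_setOf_finiteMeasure_le_of_isCompact 1 hK
  have hρS : ∀ j, ρ j ∈ S := by
    intro j
    haveI := hfin j
    constructor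
    · -- mass ≤ 1
      have h1 : (ν j) univ ≤ 1 := by
        have h := hle j 0 (Nat.zero_le j)
        simp only [pow_zero, integral_const, smul_eq_mul, mul_one] at h
        have : (ν j) univ = ENNReal.ofReal ((ν j).real univ) := (ofReal_measureReal (by finiteness)).symm
        rw [this]
        exact ENNReal.ofReal_le_one.2 h
      have h2 : ((ρ j : FiniteMeasure ℝ) : Measure ℝ) univ ≤ 1 := by
        rw [hρcoe, Measure.restrict_apply MeasurableSet.univ, univ_inter]
        exact (measure_mono (subset_univ _)).trans h1
      have h3 : ((ρ j).mass : ENNReal) ≤ 1 := by rw [FiniteMeasure.ennreal_mass]; exact h2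
      exact_mod_cast h3
    · rw [FiniteMeasure.null_iff_toMeasure_null, hρcoe, Measure.restrict_apply hKm.compl, compl_inter_self,
        measure_empty]
  have hleS : (atTop : Filter ℕ).map ρ ≤ 𝓟 S :=
    le_principal_iff.2 (mem_map.2 (univ_mem' fun j => hρS j))
  obtain ⟨νbar, hνbarS, hclu⟩ := hS.exists_clusterPt hleS
  have hclu' : MapClusterPt νbar atTop ρ := hclu
  set μb : Measure ℝ := (νbar : Measure ℝ) with hμb
  have hμbK : μb Kᶜ = 0 := (FiniteMeasure.null_iff_toMeasure_null νbar Kᶜ).1 hνbarS.2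
  have haeK : ∀ᵐ x ∂μb, x ∈ K := by
    have := measure_eq_zero_iff_ae_notMem.1 hμbK
    exact this.mono fun x hx => of_not_not hx
  /- Step 3: integrals of bounded continuous functions along the cluster point. -/
  have hcluInt : ∀ g : ℝ →ᵇ ℝ, MapClusterPt (∫ x, g x ∂μb) atTop (fun j => ∫ x, g x ∂(ρ j : Measure ℝ)) := by
    intro g
    have hcont : Continuous fun μ : FiniteMeasure ℝ => ∫ x, g x ∂(μ : Measure ℝ) :=
      FiniteMeasure.continuous_integral_boundedContinuousFunction g
    exact hclu'.tendsto_comp (hcont.tendsto νbar)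
  -- moments of the cluster point
  have hmomK : ∀ n, ∫ x, x ^ n ∂μb = u n := by
    intro n
    obtain ⟨g, hg⟩ := exists_bcf_eq_pow n
    have h1 : ∀ j, ∫ x, g x ∂(ρ j : Measure ℝ) = ∫ x in K, x ^ n ∂(ν j) := by
      intro j
      rw [hρcoe]
      exact setIntegral_congr_fun hKm fun x hx => hg x hx
    have h2 : ∫ x, g x ∂μb = u n := by
      refine eq_of_mapClusterPt_of_tendsto (hcluInt g) ?_
      simp_rw [h1]
      exact htrunc n
    rw [← h2]
    exact integral_congr_ae (haeK.mono fun x hx => (hg x hx).symm)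
  have hintb : ∀ n, Integrable (fun x : ℝ => x ^ n) μb := fun n => by
    obtain ⟨g, hg⟩ := exists_bcf_eq_pow n
    exact (g.integrable μb).congr (haeK.mono fun x hx => hg x hx)
  -- the atom at `0`
  have hzero_b : μb {0} = 0 := by
    have hδ : ∀ δ : ℝ, 0 < δ → μb.real {0} ≤ B * δ ^ 2 := by
      intro δ hδ
      obtain ⟨g, hg⟩ := exists_bcf_tent hδ
      have h1 : ∀ j, ∫ x, g x ∂(ρ j : Measure ℝ) ≤ B * δ ^ 2 := by
        intro j
        haveI := hfin j
        calc ∫ x, g x ∂(ρ j : Measure ℝ)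
            ≤ ∫ x, (Icc (-δ) δ).indicator (1 : ℝ → ℝ) x ∂(ρ j : Measure ℝ) :=
              integral_mono (g.integrable _) ((integrable_const 1).indicator measurableSet_Icc)
                fun x => (hg x).2
          _ = ((ρ j : Measure ℝ)).real (Icc (-δ) δ) := integral_indicator_one measurableSet_Icc
          _ = (ν j).real (Icc (-δ) δ ∩ K) := by rw [hρcoe, measureReal_restrict_apply measurableSet_Icc]
          _ ≤ (ν j).real (Icc 0 δ) := by
              refine measureReal_mono (fun x hx => ?_)
              simp only [hKdef, mem_inter_iff, mem_Icc] at hx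
              exact ⟨hx.2.1, hx.1.2⟩
          _ ≤ B * δ ^ 2 := by
              rw [measureReal_def]
              exact ENNReal.toReal_le_of_le_ofReal (by positivity) (hzero j δ hδ.le)
      have h2 : ∫ x, g x ∂μb ≤ B * δ ^ 2 := le_of_mapClusterPt_of_le (hcluInt g) h1
      calc μb.real {0} = ∫ x, ({0} : Set ℝ).indicator (1 : ℝ → ℝ) x ∂μb :=
            (integral_indicator_one (measurableSet_singleton 0)).symm
        _ ≤ ∫ x, g x ∂μb :=
            integral_mono ((integrable_const 1).indicator (measurableSet_singleton 0)) (g.integrable _)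
              fun x => (hg x).1
        _ ≤ B * δ ^ 2 := h2
    have hlimδ : Tendsto (fun k : ℕ => B * (1 / ((k : ℝ) + 1)) ^ 2) atTop (𝓝 0) := by
      have h : Tendsto (fun k : ℕ => 1 / ((k : ℝ) + 1)) atTop (𝓝 0) := tendsto_one_div_add_atTop_nhds_zero_nat
      have h2 := (h.pow 2).const_mul B
      simpa using h2
    have hle0 : μb.real {0} ≤ 0 :=
      ge_of_tendsto hlimδ (Eventually.of_forall fun k => hδ _ (by positivity))
    have heq0 : μb.real {0} = 0 := le_antisymm hle0 measureReal_nonneg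
    exact (measureReal_eq_zero_iff (by finiteness)).1 heq0
  -- no mass above `1`
  have hone_b : μb (Ioi 1) = 0 := by
    have hc : ∀ c : ℝ, 1 < c → μb (Ioi c) = 0 := by
      intro c hc
      have hc0 : 0 ≤ c := by linarith
      have hbound : ∀ n : ℕ, μb.real (Ioi c) ≤ (1 / c) ^ n := by
        intro n
        have h1 : c ^ n * μb.real (Ioi c) ≤ 1 := by
          calc c ^ n * μb.real (Ioi c) = ∫ x, (Ioi c).indicator (fun _ => c ^ n) x ∂μb := by
                rw [integral_indicator_const _ measurableSet_Ioi, smul_eq_mul, mul_comm]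
            _ ≤ ∫ x, x ^ n ∂μb := by
                refine integral_mono_ae ((integrable_const _).indicator measurableSet_Ioi) (hintb n) ?_
                filter_upwards [haeK] with x hx
                by_cases hxc : x ∈ Ioi c
                · rw [indicator_of_mem hxc]
                  exact pow_le_pow_left₀ hc0 (le_of_lt hxc) n
                · rw [indicator_of_notMem hxc]
                  exact pow_nonneg hx.1 n
            _ = u n := hmomK n
            _ ≤ 1 := hu1 n
        rw [one_div_pow, le_div_iff₀ (pow_pos (by linarith) n), mul_comm]
        exact h1
      have hlim0 : Tendsto (fun n : ℕ => (1 / c) ^ n) atTop (𝓝 0) :=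
        tendsto_pow_atTop_nhds_zero_of_lt_one (by positivity) ((div_lt_one (by linarith)).2 hc)
      have hle0 : μb.real (Ioi c) ≤ 0 := ge_of_tendsto hlim0 (Eventually.of_forall hbound)
      exact (measureReal_eq_zero_iff (by finiteness)).1 (le_antisymm hle0 measureReal_nonneg)
    have hcover : Ioi (1 : ℝ) ⊆ ⋃ m : ℕ, Ioi (1 + 1 / ((m : ℝ) + 1)) := by
      intro x hx
      obtain ⟨m, hm⟩ := exists_nat_one_div_lt (sub_pos.2 (mem_Ioi.1 hx))
      exact mem_iUnion.2 ⟨m, by rw [mem_Ioi]; linarith⟩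
    refine measure_mono_null hcover (measure_iUnion_null fun m => hc _ ?_)
    have : 0 < 1 / ((m : ℝ) + 1) := by positivity
    linarith
  -- hence `ν̄` lives on `(0, 1]`
  have hnullIoc : μb (Ioc (0 : ℝ) 1)ᶜ = 0 := by
    refine measure_mono_null (fun x hx => ?_) (measure_union_null (measure_union_null hμbK hzero_b) hone_b)
    simp only [mem_compl_iff, mem_Ioc, not_and_or, not_lt, not_le] at hx
    simp only [hKdef, mem_union, mem_compl_iff, mem_Icc, mem_singleton_iff, mem_Ioi, not_and_or, not_le]
    rcases hx with hx | hx
    · rcases hx.lt_or_eq with hx | hx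
      · exact Or.inl (Or.inl (Or.inl hx))
      · exact Or.inl (Or.inr hx)
    · exact Or.inr hx
  have haeIoc : ∀ᵐ x ∂μb, x ∈ Ioc (0 : ℝ) 1 :=
    (measure_eq_zero_iff_ae_notMem.1 hnullIoc).mono fun x hx => of_not_not hx
  /- Step 4: the change of variables `a = -log λ`. -/
  have hmeas : Measurable fun x : ℝ => -Real.log x := Real.measurable_log.neg
  refine ⟨μb.map fun x => -Real.log x, inferInstance, ?_, fun n => ?_⟩
  · rw [Measure.map_apply hmeas measurableSet_Ici.compl]
    refine measure_mono_null (show _ ⊆ (Ioc (0 : ℝ) 1)ᶜ from fun x hx hx' => ?_) hnullIoc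
    -- if `x ∈ (0, 1]` then `-log x ≥ 0`
    simp only [mem_preimage, mem_compl_iff, mem_Ici, not_le] at hx
    have := Real.log_nonpos hx'.1.le hx'.2
    linarith
  · rw [integral_map hmeas.aemeasurable]
    · rw [← hmomK n]
      refine integral_congr_ae (haeIoc.mono fun x hx => ?_)
      show x ^ n = Real.exp (-(-Real.log x * n))
      rw [neg_mul, neg_neg, mul_comm, Real.exp_nat_mul, Real.exp_log hx.1]
    · exact (Real.continuous_exp.comp (by fun_prop)).aestronglyMeasurable

end Limit

end AxisSpectral

/-! ### Part E. The discharge -/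

section Discharge

open _root_.MeasureTheory _root_.Filter
open scoped _root_.Topology

/-- **Aizenman–Duminil-Copin 2021, Prop. 8.6 (= Prop. 5.3), axis case, nearest-neighbour Ising
model, `m*(β) = 0` — PROVED.** For `β > 0` with `m*(β) = 0` and every axis `i` there is a finite
positive measure `μ` on `[0, ∞)` with `⟨σ₀ σ_{n eᵢ}⟩⁺_β = ∫ e^{-a|n|} dμ(a)` for all `n ∈ ℤ`.
Proof, following the printed one (App. §8.3): transfer-matrix spectral representation on the tori
`(ℤ/Nℤ)^{d'+1}` (`exists_torusAxisMeasure`, from `TorusTransferSpectral` / `TwoPointLogConvex`),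
convergence of the periodic two-point function to `⟨σ₀σ_x⟩⁺_β` when `m*(β) = 0`
(`tendsto_isingTorusTwoPoint_proj_of_magnetization_eq_zero`, ADC Prop. 5.2), and the moment /
weak-compactness limit (`exists_laplace_of_momentLimit`); the absence of an atom at `e^{-a} = 0`,
not addressed in the printed proof, comes from the intertwiner bound of Part B.
[cite: AizenmanDuminilCopinAnnals2021, Appendix §8.3 Prop. 8.6 (= Prop. 5.3) and its proof] -/
theorem AizenmanDuminilCopin2021_prop_8_6_holds : AizenmanDuminilCopin2021_prop_8_6 := by
  intro d' β hβ hm i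
  classical
  -- finite-volume spectral measures on the tori `(ℤ/(j+3)ℤ)^{d'+1}`
  obtain ⟨B, hB0, hB⟩ := AxisSpectral.exists_torusAxisMeasure hβ d'
  have hex : ∀ j : ℕ, ∃ ν : Measure ℝ, IsFiniteMeasure ν ∧ ν (Set.Iio 0) = 0 ∧
      (∀ n : ℕ, Integrable (fun x : ℝ => x ^ n) ν) ∧
      (∀ n : ℕ, n < j + 3 → ∫ x, x ^ n ∂ν =
        isingTorusTwoPoint (d' + 1) (j + 3) β 0 0 (Pi.single i (n : ZMod (j + 3)))) ∧
      ∀ δ : ℝ, 0 ≤ δ → ν (Set.Icc 0 δ) ≤ ENNReal.ofReal (B * δ ^ 2) :=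
    fun j => hB (j + 3) (by omega) i
  choose ν hfin hsupp hint hmom hzero using hex
  set u : ℕ → ℝ := fun n => twoPointPlus (d' + 1) β (Pi.single i ((n : ℕ) : ℤ)) with hu
  -- the torus moments converge to the infinite-volume two-point function (`m*(β) = 0`)
  have hlim : ∀ n, Tendsto (fun j => ∫ x, x ^ n ∂(ν j)) atTop (𝓝 (u n)) := by
    intro n
    have hN : Tendsto (fun j : ℕ => j + 3) atTop atTop := tendsto_add_atTop_nat 3
    have key := tendsto_isingTorusTwoPoint_proj_of_magnetization_eq_zero (Nseq := fun j => j + 3) hβ.le hm hN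
      (Pi.single i ((n : ℕ) : ℤ))
    refine key.congr' ?_
    rw [EventuallyEq, eventually_atTop]
    refine ⟨n, fun j hj => ?_⟩
    rw [Torus.proj_single, Int.cast_natCast, hmom j n (by omega)]
  have hle : ∀ j n, n ≤ j → ∫ x, x ^ n ∂(ν j) ≤ 1 := fun j n hnj => by
    rw [hmom j n (by omega)]
    exact isingTorusTwoPoint_le_one _ _ _ _
  obtain ⟨μ, hμfin, hμsupp, hμ⟩ := AxisSpectral.exists_laplace_of_momentLimit u ν hfin hB0 hsupp hint hle
    hlim hzero
  refine ⟨μ, hμfin, hμsupp, fun n => ?_⟩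
  -- `n : ℤ`: reduce to `|n| : ℕ` by the reflection symmetry of `⟨σ₀σ_x⟩⁺`
  have hsymm : twoPointPlus (d' + 1) β (Pi.single i n) = u n.natAbs := by
    simp only [hu]
    rcases Int.natAbs_eq n with h | h
    · rw [← h]
    · conv_lhs => rw [h]
      rw [← twoPointPlus_neg β (Pi.single i (-(n.natAbs : ℤ)))]
      congr 1
      rw [Pi.single_neg, neg_neg]
  rw [hsymm, hμ n.natAbs]
  refine integral_congr_ae (Eventually.of_forall fun a => ?_)
  show Real.exp (-(a * (n.natAbs : ℕ))) = Real.exp (-(a * |(n : ℝ)|))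
  rw [Nat.cast_natAbs, Int.cast_abs]

end Discharge

end Literature.Probability.LatticeModels

end
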